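import Summits.ResolutionOfSingularities.ResolutionOfSingularities.Theorems.FrobeniusClosingPatchingRelPerfectAlgebraizeBlowupHelpers
import Literature.AlgebraicGeometry.Resolution.Hironaka1964LocalComplete
import Literature.AlgebraicGeometry.Resolution.AdicCompletionRegular
import HarnessLib

/-!
# Crux `PatchingRelPerfect` (stmt-ResolutionOfSingularities-16161), line `closed-point-slice`:
# stub `stub_algebraizeBlowup` — completion descent in blow-up format

Route `ResolutionOfSingularities/FrobeniusClosing`, crux #6 `PatchingRelPerfect`
(`∀ p prime, RelLUPerfect p → ResPerfect p`). This file proves the registered stub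
`stub_algebraizeBlowup` of the line `closed-point-slice` (skeleton v2.1), verbatim:
`PunctualCompletePerfect p 4 → PunctualPerfClosed p 4` — punctual resolution in single-blow-up
format over a COMPLETE regular local base of dimension `≤ 4`, equal characteristic `p`, perfect
residue field (the ATOM, hypothesis `h`) implies the same over an ALGEBRAIC base: `S` regular
local, essentially of finite type over a perfect field `k` of characteristic `p`, `dim S ≤ 4`,
`S/𝔪` finite over `k`; for `f : T → Spec S` proper birational with `T` integral and regular off
the closed fibre there is a non-zero ideal sheaf `J₀` on `T`, cosupported in the closed fibre,
whose blowing up has regular source.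

## Proof (Temkin 2008, proof of Thm. 3.4.1, with `T ×_S Spec Ŝ` for the formal completion)

1. `Ŝ = Ŝ_𝔪` is regular local (`isRegularLocalRing_adicCompletion`), `dim Ŝ = dim S`
   (`ringKrullDim_adicCompletion`), `𝔪̂`-adically complete (Mathlib), of characteristic `p` with
   residue field `S/𝔪` perfect, and `S → Ŝ` is a regular homomorphism (`S` excellent) — the
   registered sub-goal `stub_algebraizeBlowupCompletion` of the helpers file.
2. `T̂ = T ×_S Spec Ŝ → Spec Ŝ` is proper (base change) and birational
   (`isBirational_pullback_snd_specMap`: the projection `φ : T̂ → T` is flat hence generizing),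
   so `T̂` is irreducible; it is reduced (`isReduced_pullback_specMap_of_isRegularHom`, Stacks
   07C1 + 07QK), hence integral; and regular off the closed fibre by regular ascent along `φ`
   (`isRegularLocalRing_stalk_pullback_of_isRegularHom`, Matsumura 23.7 (ii)), the closed point
   of `Spec Ŝ` being the only point over the closed point of `Spec S`.
3. The atom gives `Ĵ ≠ 0` on `T̂`, cosupported in the closed fibre, with `Bl_Ĵ T̂` regular.
4. `Ĵ ⊇ (𝔪 𝒪_T̂)ᴺ⁺¹` (`exists_pow_succ_le_of_support_subset`), so `Ĵ = J₀ 𝒪_T̂` for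
   `J₀ = φ_* Ĵ ∩ 𝒪_T` (`comap_map_fst_eq_of_pow_le`: `Γ(T̂, φ⁻¹W) ≅ Γ(T, W) ⊗_S Ŝ ≡ Γ(T, W)`
   modulo `𝔪ᴺ⁺¹`); `J₀ ≠ 0` and `Supp J₀ = cl φ(Supp Ĵ)` lies in the closed fibre.
5. `Bl_{J₀} T` exists (`exists_isBlowup`); `Bl_{J₀} T ×_T T̂ ≅ Bl_Ĵ T̂` (flat base change of
   blow-ups `IsBlowup.of_isPullback_of_flat`, pasting `IsPullback.of_bot'`, uniqueness) is
   regular; a point of `Bl_{J₀} T` over the closed point lies under a point of it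
   (`Scheme.Pullback.exists_preimage_pullback` with the closed point of `Spec Ŝ`), and regularity
   descends along the flat projection (Matsumura 23.7 (i), `IsRegularLocalRing.of_flat_ringHom`);
   off the closed fibre `Bl_{J₀} T → T` is a local isomorphism (`IsBlowup.isIso_compl`) onto the
   regular open `T ∖ f⁻¹(𝔪)`.

The architecture is that of `affine_of_complete` (`Hironaka1964LocalComplete.lean`, the `g`-adic
case); nothing here mentions the route, and no definition or named fact is introduced.

## Sources

* M. Temkin, *Desingularization of quasi-excellent schemes in characteristic zero*, Adv. Math.
  219 (2008) 488–522: Lemma 2.1.8, Lemma 3.1.4, Cor. 3.1.5, Thm. 3.4.1 (proof, p. 18). [Temkin2008]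
* U. Görtz, T. Wedhorn, *Algebraic Geometry I* (2nd ed., 2020), Def. 13.90, Prop. 13.91 (blow-ups
  and flat base change). [GortzWedhorn2020]
* H. Matsumura, *Commutative Ring Theory*, CUP 1986, Thm. 23.7. [Matsumura1987]
* A. Grothendieck, EGA IV₂ (7.8.3) (v), (7.9.3). [EGAIV2]
-/

set_option linter.dupNamespace false -- single-problem summit: doubled namespace component is forced

noncomputable section

open CategoryTheory CategoryTheory.Limits AlgebraicGeometry Literature.AlgebraicGeometry.Resolution
open IsLocalRing TensorProduct TopologicalSpace

namespace Summit.ResolutionOfSingularities.ResolutionOfSingularities.Theorems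

/-- **Completion descent in blow-up format**
(`PunctualCompletePerfect p 4 → PunctualPerfClosed p 4`, stub `stub_algebraizeBlowup` of the line
`closed-point-slice`, registered signature verbatim).
Let `k` be perfect of characteristic `p`, `S` regular local, essentially of finite type over `k`,
`dim S ≤ 4`, `S/𝔪` finite over `k`, and `f : T → Spec S` proper birational with `T` integral
and regular off the closed fibre. Complete: `Ŝ = Ŝ_𝔪` is regular local
(`isRegularLocalRing_adicCompletion`) of the same dimension, of characteristic `p`, `𝔪̂`-adically
complete, with residue field `S/𝔪` perfect; `T̂ = T ×_S Spec Ŝ` is integral (irreducible by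
birationality and flatness of `T̂ → T`; reduced along the regular homomorphism `S → Ŝ`, `S`
being excellent), proper and birational over `Spec Ŝ`, and regular off the closed fibre
(regular ascent along `T̂ → T`). The atom `h` gives a non-zero centre `Ĵ` on `T̂`, cosupported in
the closed fibre, with `Bl_Ĵ T̂` regular. Then `Ĵ ⊇ (𝔪 𝒪_T̂)ᴺ`
(`exists_pow_succ_le_of_support_subset`), so `Ĵ = J₀ 𝒪_T̂` for `J₀ = φ_* Ĵ ∩ 𝒪_T`
(`comap_map_fst_eq_of_pow_le`: `𝒪_T̂ ≡ 𝒪_T (mod 𝔪ᴺ)`);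
`J₀ ≠ 0` is cosupported in the closed fibre; `Bl_{J₀} T ×_T T̂ ≅ Bl_Ĵ T̂` (blow-ups commute with
the flat base change, `IsBlowup.of_isPullback_of_flat`, uniqueness) is regular, every point of
`Bl_{J₀} T` over the closed point lies under a point of it and regularity descends along the flat
projection (Matsumura 23.7 (i), `IsRegularLocalRing.of_flat_ringHom`), while off the closed fibre
`Bl_{J₀} T → T` is a local isomorphism onto the regular `T ∖ f⁻¹(𝔪)`.
[cite: Temkin2008, Thm. 3.4.1 (proof, p. 18), Lemma 3.1.4, Cor. 3.1.5]
[cite: GortzWedhorn2020, Def. 13.90 and Prop. 13.91] [cite: Matsumura1987, Thm. 23.7] -/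
theorem stub_algebraizeBlowup (p : ℕ) (hp : p.Prime)
    (h : ∀ (S : Type) [CommRing S] [IsRegularLocalRing S] [CharP S p]
      [IsAdicComplete (IsLocalRing.maximalIdeal S) S]
      [PerfectField (IsLocalRing.ResidueField S)], ringKrullDim S ≤ (4 : ℕ) →
      ∀ (T : Scheme.{0}) (f : T ⟶ Spec (.of S)), IsIntegral T → IsProper f → IsBirational f →
        (∀ t : T, f.base t ≠ IsLocalRing.closedPoint S → IsRegularLocalRing (T.presheaf.stalk t)) →
        ∃ (J : T.IdealSheafData) (T' : Scheme.{0}) (π : T' ⟶ T), J ≠ ⊥ ∧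
          (∀ t : T, t ∈ J.support → f.base t = IsLocalRing.closedPoint S) ∧
          IsBlowup π J ∧ Scheme.IsRegular T')
    (k : Type) [Field k] [CharP k p] [PerfectField k] (S : Type) [CommRing S] [IsRegularLocalRing S]
    [Algebra k S] [Algebra.EssFiniteType k S] (hdim : ringKrullDim S ≤ (4 : ℕ))
    (hfin : Module.Finite k (S ⧸ IsLocalRing.maximalIdeal S))
    (T : Scheme.{0}) (f : T ⟶ Spec (.of S)) [IsIntegral T] [IsProper f] (hbir : IsBirational f)
    (hoff : ∀ t : T, f.base t ≠ IsLocalRing.closedPoint S → IsRegularLocalRing (T.presheaf.stalk t)) :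
    ∃ (J : T.IdealSheafData) (T' : Scheme.{0}) (π : T' ⟶ T), J ≠ ⊥ ∧
      (∀ t : T, t ∈ J.support → f.base t = IsLocalRing.closedPoint S) ∧
      IsBlowup π J ∧ Scheme.IsRegular T' := by
  have _ := hp -- the primality of `p` is not used
  -- Noetherian bookkeeping downstairs
  haveI : IsNoetherianRing (CommRingCat.of S) := (inferInstance : IsNoetherianRing S)
  haveI : IsDomain S := isDomain_of_isRegularLocalRing S
  haveI : IsLocallyNoetherian T := LocallyOfFiniteType.isLocallyNoetherian f
  have hfg : (maximalIdeal S).FG := (maximalIdeal S).fg_of_isNoetherianRing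
  -- Step 1: the completion `Ŝ` and its structure
  let E : Type := AdicCompletion (maximalIdeal S) S
  haveI : IsRegularLocalRing E := isRegularLocalRing_adicCompletion S
  haveI : IsDomain E := isDomain_of_isRegularLocalRing E
  haveI : IsNoetherianRing (CommRingCat.of E) := (inferInstance : IsNoetherianRing E)
  obtain ⟨hchar, hperf, hREG⟩ := stub_algebraizeBlowupCompletion p k S hfin
  haveI : CharP E p := hchar
  haveI : PerfectField (ResidueField E) := hperf
  have hdimE : ringKrullDim E ≤ (4 : ℕ) := by
    have h1 : ringKrullDim E = ringKrullDim S := ringKrullDim_adicCompletion S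
    rw [h1]
    exact hdim
  haveI : Module.Flat S E := inferInstance
  have hinj : Function.Injective (algebraMap S E) :=
    AdicCompletion.of_injective (maximalIdeal S) S
  let g : Spec (.of E) ⟶ Spec (.of S) := specOfAlgebra S E
  haveI : Flat g := by
    refine (HasRingHomProperty.Spec_iff (P := @Flat)).mpr ?_
    change (algebraMap S E).Flat
    exact RingHom.flat_algebraMap_iff.mpr inferInstance
  have hclosed : ∀ q : Spec (.of E), g q = closedPoint S ↔ q = closedPoint E :=
    specMap_eq_closedPoint_iff S
  -- Step 2: the base change `T̂ = T ×_S Spec Ŝ`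
  let Th : Scheme.{0} := pullback f g
  let φ : Th ⟶ T := pullback.fst f g
  let fh : Th ⟶ Spec (.of E) := pullback.snd f g
  haveI : Flat φ := MorphismProperty.pullback_fst _ _ inferInstance
  haveI : IsProper fh := MorphismProperty.pullback_snd _ _ inferInstance
  have hbirh : IsBirational fh := isBirational_pullback_snd_specMap hinj f hbir
  haveI : IrreducibleSpace (Spec (.of E) : Scheme.{0}) :=
    inferInstanceAs (IrreducibleSpace (PrimeSpectrum E))
  haveI : IrreducibleSpace Th := hbirh.irreducibleSpace
  haveI : IsReduced Th := isReduced_pullback_specMap_of_isRegularHom E hREG f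
  haveI : IsIntegral Th := isIntegral_of_irreducibleSpace_of_isReduced Th
  haveI : IsLocallyNoetherian Th := LocallyOfFiniteType.isLocallyNoetherian fh
  haveI : CompactSpace Th := QuasiCompact.compactSpace_of_compactSpace fh
  have hfφ : ∀ z : Th, f (φ z) = g (fh z) := fun z => by
    rw [← Scheme.Hom.comp_apply, ← Scheme.Hom.comp_apply, pullback.condition]
  -- `T̂` is regular off the closed fibre (regular ascent along `φ`)
  have hoffh : ∀ z : Th, fh.base z ≠ closedPoint E → IsRegularLocalRing (Th.presheaf.stalk z) := by
    intro z hz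
    refine isRegularLocalRing_stalk_pullback_of_isRegularHom E hREG f z (hoff _ fun h1 => hz ?_)
    exact (hclosed _).mp ((hfφ z).symm.trans h1)
  -- Step 3: the atom over the complete base
  obtain ⟨Jh, Th', πh, hJh0, hJhsupp, hπh, hTh'reg⟩ :=
    h E hdimE Th fh inferInstance inferInstance hbirh hoffh
  -- Step 4: the closed-fibre ideal sheaves `G = 𝔪 𝒪_T`, `H = 𝔪 𝒪_T̂ = φ⁻¹ G`
  let sM : Ideal Γ(Spec (.of S), ⊤) := (maximalIdeal S).map (Scheme.ΓSpecIso (.of S)).inv.hom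
  let G : T.IdealSheafData := (Scheme.IdealSheafData.ofIdealTop sM).comap f
  have hGsupp : ∀ t : T, t ∈ (G.support : Set T) ↔ f t = closedPoint S := by
    intro t
    change t ∈ (((Scheme.IdealSheafData.ofIdealTop sM).comap f).support : Set T) ↔ _
    rw [Scheme.IdealSheafData.support_comap, TopologicalSpace.Closeds.coe_preimage,
      Set.mem_preimage, Scheme.IdealSheafData.coe_support_ofIdealTop, Scheme.mem_zeroLocus_iff]
    have hbo : ∀ s : Γ(Spec (.of S), ⊤), f t ∈ (Spec (.of S)).basicOpen s ↔
        (Scheme.ΓSpecIso (.of S)).hom.hom s ∉ (f t).asIdeal := fun s => by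
      rw [basicOpen_eq_of_affine']
      rfl
    have hsurj : Function.Surjective (Scheme.ΓSpecIso (.of S)).inv.hom :=
      (Scheme.ΓSpecIso (.of S)).commRingCatIsoToRingEquiv.symm.surjective
    constructor
    · intro hall
      have hle : maximalIdeal S ≤ (f t).asIdeal := fun m hm => by
        have h1 := hall ((Scheme.ΓSpecIso (.of S)).inv.hom m) (Ideal.mem_map_of_mem _ hm)
        rw [hbo, not_not, ← CommRingCat.comp_apply, Iso.inv_hom_id, CommRingCat.id_apply] at h1
        exact h1
      apply PrimeSpectrum.ext
      exact ((IsLocalRing.maximalIdeal.isMaximal S).eq_of_le (f t).2.ne_top hle).symm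
    · intro ht s hs hts
      obtain ⟨m, hm, rfl⟩ := (Ideal.mem_map_iff_of_surjective _ hsurj).mp hs
      rw [hbo, ← CommRingCat.comp_apply, Iso.inv_hom_id, CommRingCat.id_apply, ht] at hts
      exact hts hm
  let H : Th.IdealSheafData := G.comap φ
  have hHsupp : ∀ z : Th, z ∈ (H.support : Set Th) ↔ fh z = closedPoint E := by
    intro z
    change z ∈ ((G.comap φ).support : Set Th) ↔ _
    rw [Scheme.IdealSheafData.support_comap, TopologicalSpace.Closeds.coe_preimage,
      Set.mem_preimage, hGsupp, hfφ, hclosed]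
  -- Step 5: `Ĵ ⊇ Hᴺ⁺¹`, so `Ĵ` is extended from `J₀ = φ_* Ĵ ∩ 𝒪_T`
  have hJhH : (Jh.support : Set Th) ⊆ H.support := fun z hz => (hHsupp z).mpr (hJhsupp z hz)
  obtain ⟨N, hN⟩ := exists_pow_succ_le_of_support_subset hJhH
  haveI : IsAffineHom g := inferInstance
  haveI : IsAffineHom φ := MorphismProperty.pullback_fst _ _ inferInstance
  let J₀ : T.IdealSheafData := Jh.map φ
  have hJcomap : J₀.comap φ = Jh :=
    comap_map_fst_eq_of_pow_le E (maximalIdeal S) (N + 1)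
      (fun B _ _ w => exists_sub_tmul_one_mem_map_pow (maximalIdeal S) hfg (N + 1) B w) f Jh hN
  have hJ0ne : J₀ ≠ ⊥ := by
    intro h0
    apply hJh0
    rw [← hJcomap, h0, Scheme.IdealSheafData.comap_bot]
  have hJ0G : (J₀.support : Set T) ⊆ G.support := by
    change ((Jh.map φ).support : Set T) ⊆ _
    rw [Scheme.IdealSheafData.support_map, TopologicalSpace.Closeds.coe_closure]
    refine G.support.isClosed.closure_subset_iff.mpr ?_
    rintro _ ⟨z, hz, rfl⟩
    exact (hGsupp _).mpr (by rw [hfφ]; exact (hclosed _).mpr (hJhsupp z hz))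
  have hJ0supp : ∀ t : T, t ∈ J₀.support → f.base t = closedPoint S :=
    fun t ht => (hGsupp t).mp (hJ0G ht)
  -- Step 6: blow up `T` along `J₀`; its base change to `Ŝ` is `Bl_Ĵ T̂`, regular
  obtain ⟨T', π', hπ'⟩ := exists_isBlowup T J₀
  haveI : IsProper π' := hπ'.isProper
  haveI : IsLocallyNoetherian T' := LocallyOfFiniteType.isLocallyNoetherian π'
  let Th' : Scheme.{0} := pullback (π' ≫ f) g
  let φ' : Th' ⟶ T' := pullback.fst (π' ≫ f) g
  haveI : Flat φ' := MorphismProperty.pullback_fst _ _ inferInstance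
  have tsq : IsPullback φ fh f g := IsPullback.of_hasPullback f g
  have bigsq : IsPullback φ' (pullback.snd (π' ≫ f) g) (π' ≫ f) g := IsPullback.of_hasPullback _ _
  have sq := IsPullback.of_bot' bigsq tsq
  have hρ : IsBlowup (tsq.lift (φ' ≫ π') (pullback.snd (π' ≫ f) g)
      (by rw [Category.assoc, bigsq.w])) Jh := by
    have := hπ'.of_isPullback_of_flat sq
    rwa [hJcomap] at this
  obtain ⟨e, -, -⟩ := hρ.unique hπh
  have hTh'reg2 : Scheme.IsRegular Th' := fun z =>
    (Scheme.mem_regularLocus _).mp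
      ((mem_regularLocus_iff_of_flat_of_isPreimmersion e.hom z).mpr
        ((Scheme.mem_regularLocus _).mpr (hTh'reg _)))
  -- Step 7: `Bl_{J₀} T` is regular
  have hT'reg : Scheme.IsRegular T' := by
    intro y₁
    by_cases hy : f (π' y₁) = closedPoint S
    · -- over the closed point: a point of `Bl_Ĵ T̂` above `y₁`, and flat descent
      have hcond : (π' ≫ f) y₁ = g (closedPoint E) := by
        rw [Scheme.Hom.comp_apply, hy, (hclosed _).mpr rfl]
      obtain ⟨z₁, hz₁, -⟩ :=
        Scheme.Pullback.exists_preimage_pullback (f := π' ≫ f) (g := g) y₁ (closedPoint E) hcond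
      haveI : IsRegularLocalRing (Th'.presheaf.stalk z₁) := hTh'reg2 z₁
      subst hz₁
      exact IsRegularLocalRing.of_flat_ringHom (φ'.stalkMap z₁).hom (Flat.stalkMap φ' z₁)
    · -- off the closed fibre: `π'` is an isomorphism near `y₁` and `T` is regular there
      have h1 : π' y₁ ∉ (J₀.support : Set T) := fun h => hy (hJ0supp _ h)
      haveI := hπ'.isIso_compl
      refine (Scheme.mem_regularLocus _).mp ((mem_regularLocus_iff_of_isIso_morphismRestrict π'
        ⟨(J₀.support : Set T)ᶜ, J₀.support.isClosed.isOpen_compl⟩ y₁ h1).mpr ?_)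
      exact (Scheme.mem_regularLocus _).mpr (hoff _ hy)
  exact ⟨J₀, T', π', hJ0ne, hJ0supp, hπ', hT'reg⟩

end Summit.ResolutionOfSingularities.ResolutionOfSingularities.Theorems

end
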